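import Summits.QuantumFields.YangMills.Theorems.BalabanUVNodesN16H7LooseOfReg910Slot
import Summits.QuantumFields.BalabanUV.T4Continuum.Support.MinimalActionExistence
import HarnessLib

/-!
# Route «BalabanUVNodes» (K3⁷ `SpineGivenEndpointR13SepCoPH`, stmt-QuantumFields-20544), DAG node N16 = NE3, in-edge N07 → N16 — THE SLOT KEY IN TREE-PRIMITIVE NORMAL FORM:
# (T8) «an (8)-class minimiser exists at every loose datum» ⟺ «the admissible set is NON-EMPTY» (compactness is in the tree), and
# «∃ G, RadiiMono ∧ interface ∧ (T9ˢ)(G, C)» ⟺ the G-FREE per-site form (T9♭)(C) — leaf-06's local-gauge slot `G` carries no content beyond the (9)_{β₀=1} data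

Cell `pub-ymgap`, width seat `pub-ymgap-dag-n16-w1` (director-ym №197 ∕ HUMAN RULING D-0149), generation 5, file 12 of this lineage (files 9∕9b∕10∕11: `…N16H7LooseOfReg910Slot[Family]`
p609800∕p613191, `…N16H7OfN07RecordSlotKey` p613213, `…N16SlotKeyWitnesses` p612064).  `--kind proof --supports stmt-QuantumFields-20544 --as helper` (count-neutral).
`bears_on: R4∕N16 · edge N07 → N16`.  THEOREMS ONLY (0 `def`, 0 `sorry`, standard axioms); BY NAME over leaf-05's `MinimalActionExistence.exists_isMinimiser_of_nonempty`
(cell `pub-balaban`: the admissible set of a run over the small-field class is COMPACT and the Wilson action continuous — Tychonoff × `U(N)`, (43) continuous) and leaf-06's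
`MinimalActionDictionary` (`torusVP`, `gaugeFactors`, `gaugeInf`, `cubeM`).

THE POINT.  After files 9–11 the (β16) loose road's N07 in-edge is the SLOT KEY `(G, hGm, hG, C, hR, hE)` (file 9 §1).  Two of its letters are still leaf-06 ARTEFACTS: the
abstract local-gauge shape `G` (with its monotonicity `hGm` and (9)_{β₀=1} interface `hG`) and the word «minimiser» in (T8).  This file eliminates both, so that what node
N07 is asked for — and what a disprover of dag-n16-e's ∕ dag-n16-w2's DischargeTest v6 ∕ v6L `stub_reg910Slot := ∃ G C, RadiiMono ∧ interface ∧ hR` must attack — reads in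
the tree's PRIMITIVES only:
* (A) **(T8) ⟺ NON-EMPTINESS.**  `exists8Min_iff_nonempty_admissible`: in the radius regime `16·C₀·B₃a₁ ≤ 3`, `1024(d+1)(d+4)L²·B₃a₁ ≤ 1` (leaf-05's, explicit; `L ≥ 2`), «for
  every run `k+1`, `0 < ε₁ ≤ a₁` and `V ∈ sfClass d L N ε₁ 0` SOME minimiser over `sfClass d L N (B₃ε₁) (k+1)` at `V` exists» IFF «the admissible set
  `{U ∈ sfClass d L N (B₃ε₁) (k+1) ∣ avgIter L U (k+1) = V}` is non-empty» — i.e. (8) at the (42)-objects is the EXACT-INTERPOLATION statement «every `ε₁`-small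
  `N`-periodic unit-lattice datum IS the `(k+1)`-fold (42)-average of SOME `U(N)`-valued `(N·L^{k+1})`-periodic configuration with plaquettes within `B₃ε₁·L^{−2(k+1)}` of
  `1`», uniformly in `k` with ONE `B₃`; no minimality, no regularity.  (Print obtains it only INSIDE Theorem 1's induction on k — Sect. A (11)–(14), Props 7–8 — from
  the previous level's minimiser; the kinematic one-step refinement of the tree, `ApproxRefineEnd.approxRefine_sfClass`, inflates the small-field letter by a factor
  `≥ 4(8d−7)` per level and does NOT give it — recorded so nobody retries.)
* (B) **THE G-SLOT IS EMPTY OF CONTENT.**  `slotKey_iff_perSite`: for every `C`, `(∃ G, RadiiMono d G ∧ interface G ∧ (T9ˢ)(G, C))` IFF (T9♭)(C) := «for every run `k+1`,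
  `0 < ε₁ ≤ a₁`, loose datum `V`, (8)-class minimiser `U` and site `x` there are a factor `0 ≤ t < B₃·M_k·ε₁` (`M_k = cubeM L (k+1) (L^{k+1}−1+L^{k+1}+2) ∈ [2, 11∕4]`, file 9
  `two_le_cubeM_slot`) and a unitary gauge `u`, potential `a` with `U^u = exp a` on the bonds within `|·|₁ ≤ 2` of `x`, `‖a‖ ≤ t∕L^{k+1}` there, `‖∇a‖ ≤ t∕L^{2(k+1)}` within
  `|·|₁ ≤ 1`, `‖∇∇a(x)‖ ≤ t∕L^{3(k+1)}`» — file 1 §2's per-site (9)_{β₀=1} data with the printed M-proportional factor `B₃Mε₁` ([Balaban1985Variational] (9) p. 279).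
  ⟹ (`perSite_of_reg910Slot`): the instance's infimum `Ψ <` bound yields a witness `t`, then the interface.  ⟸ (`reg910Slot_of_perSite`): take `G :=` the per-site
  predicate itself; `RadiiMono` and the interface hold by construction, and r2's `Regularity` for the instance follows from `t` (`csInf_le`; the Hölder slot of the
  instance is `0 <` its bound).

HONEST FRAMING.  Logical normal forms of a DISPLAYED hypothesis (node N07's content = [Balaban1985Variational] Thm 1 (8)–(10) at the (42)-objects) over landed definitions;
NOTHING of Bałaban asserted, refuted, or inhabited beyond file 11's flat sector; `stub_h7` NOT closed; no stub of K3⁷ v5 named or closed; N16 ∕ N07 NOT discharged;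
count-neutral; counts of record unmoved (typed 28∕28 · discharged 5∕28); one finite four-torus at fixed `ε`, Bałaban AS PRINTED — NOT ℝ⁴, NOT infinite volume, NOT OS, NOT
a mass gap; the YM mass gap (Clay) is NOT proved by any of this — R4 closes the conditional finite-𝕋⁴ rung `BalabanLadder.UV` only.
-/

set_option autoImplicit false

open scoped BigOperators Matrix Matrix.Norms.L2Operator
open NormedSpace

namespace Summit.QuantumFields.YangMills.BalabanUVNodes.N16SlotKeyNormalForm

open Literature.MathematicalPhysics.QuantumFieldTheory.Balaban1983to89
open B7Prop1Explicit B7Prop2Explicit MatrixLog UnitaryModel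
open T4AveragingDeficitWall hiding Site Plane Plaq Bond
open Summit.QuantumFields.BalabanUV.T4Continuum
open AveragingDeficitLatticeH2Prep (fd)
open MinimalActionSandwich (IsMinimiser admissible)
open MinimalActionRate (sfClass)
open MinimalActionDictionary (torusVP RadiiMono cubeM cubeM_pos gaugeFactors gaugeInf)
open MinimalActionExistence (exists_isMinimiser_of_nonempty)
open B11 (Regularity)

noncomputable section

variable {d : ℕ} {n : Type} [Fintype n] [DecidableEq n]

/-! ## §1 (T8) ⟺ the admissible set is non-empty -/

/-- A minimiser is admissible: (T8) ⟹ non-emptiness of `admissible (sfClass d L N (B₃ε₁)) L (k+1) V` at every loose datum. [folklore] -/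
theorem nonempty_admissible_of_exists8Min {L N : ℕ} (C : B11Thm1.Consts)
    (hE : ∀ (k : ℕ) (ε₁ : ℝ), 0 < ε₁ → ε₁ ≤ C.a₁ → ∀ V : Site d → Fin d → (Matrix n n ℂ)ˣ, V ∈ sfClass d L N ε₁ 0 →
      ∃ U : Site d → Fin d → (Matrix n n ℂ)ˣ, IsMinimiser d (sfClass d L N (C.B₃ * ε₁)) L N (k + 1) V U) :
    ∀ (k : ℕ) (ε₁ : ℝ), 0 < ε₁ → ε₁ ≤ C.a₁ → ∀ V : Site d → Fin d → (Matrix n n ℂ)ˣ, V ∈ sfClass d L N ε₁ 0 →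
      (admissible (sfClass d L N (C.B₃ * ε₁)) L (k + 1) V).Nonempty := by
  intro k ε₁ hε₁ hε₁a V hV
  obtain ⟨U, hU⟩ := hE k ε₁ hε₁ hε₁a V hV
  exact ⟨U, hU.mem⟩

/-- **★ (T8) ⟸ NON-EMPTINESS OF THE ADMISSIBLE SET** (leaf-05's compactness BY NAME): in the radius regime `16·C₀·B₃a₁ ≤ 3`, `1024(d+1)(d+4)L²·B₃a₁ ≤ 1` (monotone in
`ε₁ ≤ a₁`), `L ≥ 2`, if for every run `k+1`, every `0 < ε₁ ≤ a₁` and every `V ∈ sfClass d L N ε₁ 0` SOME configuration of `sfClass d L N (B₃ε₁) (k+1)` has `(k+1)`-fold average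
`V`, then a MINIMISER of that run exists there (`MinimalActionExistence.exists_isMinimiser_of_nonempty`: compact admissible set, continuous Wilson action).  So the existence
half (8) of the slot key is an exact-interpolation statement; no minimality is asked of node N07 for it. [cite: Balaban1985Variational, Thm 1 (8) p.279] -/
theorem exists8Min_of_nonempty_admissible [Nonempty n] {L N : ℕ} (hL : 2 ≤ L) (C : B11Thm1.Consts)
    (hr1 : 16 * C0 d * (C.B₃ * C.a₁) ≤ 3) (hr2 : 1024 * (d + 1) * (d + 4) * (L : ℝ) ^ 2 * (C.B₃ * C.a₁) ≤ 1)
    (hI : ∀ (k : ℕ) (ε₁ : ℝ), 0 < ε₁ → ε₁ ≤ C.a₁ → ∀ V : Site d → Fin d → (Matrix n n ℂ)ˣ, V ∈ sfClass d L N ε₁ 0 →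
      (admissible (sfClass d L N (C.B₃ * ε₁)) L (k + 1) V).Nonempty) :
    ∀ (k : ℕ) (ε₁ : ℝ), 0 < ε₁ → ε₁ ≤ C.a₁ → ∀ V : Site d → Fin d → (Matrix n n ℂ)ˣ, V ∈ sfClass d L N ε₁ 0 →
      ∃ U : Site d → Fin d → (Matrix n n ℂ)ˣ, IsMinimiser d (sfClass d L N (C.B₃ * ε₁)) L N (k + 1) V U := by
  intro k ε₁ hε₁ hε₁a V hV
  have hB₃ := C.B₃_pos
  have hε0 : 0 ≤ C.B₃ * ε₁ := by positivity
  have hmono : C.B₃ * ε₁ ≤ C.B₃ * C.a₁ := mul_le_mul_of_nonneg_left hε₁a hB₃.le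
  have hC0 : 0 ≤ 16 * C0 d := by have := C0_pos d; positivity
  have h1 : 16 * C0 d * (C.B₃ * ε₁) ≤ 3 := (mul_le_mul_of_nonneg_left hmono hC0).trans hr1
  have h2 : 1024 * (d + 1) * (d + 4) * (L : ℝ) ^ 2 * (C.B₃ * ε₁) ≤ 1 :=
    (mul_le_mul_of_nonneg_left hmono (by positivity)).trans hr2
  exact exists_isMinimiser_of_nonempty hL hε0 h1 h2 (hI k ε₁ hε₁ hε₁a V hV)

/-- **(T8) ⟺ NON-EMPTINESS** in the radius regime (the two directions above). [cite: Balaban1985Variational, Thm 1 (8) p.279] -/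
theorem exists8Min_iff_nonempty_admissible [Nonempty n] {L N : ℕ} (hL : 2 ≤ L) (C : B11Thm1.Consts)
    (hr1 : 16 * C0 d * (C.B₃ * C.a₁) ≤ 3) (hr2 : 1024 * (d + 1) * (d + 4) * (L : ℝ) ^ 2 * (C.B₃ * C.a₁) ≤ 1) :
    (∀ (k : ℕ) (ε₁ : ℝ), 0 < ε₁ → ε₁ ≤ C.a₁ → ∀ V : Site d → Fin d → (Matrix n n ℂ)ˣ, V ∈ sfClass d L N ε₁ 0 →
      ∃ U : Site d → Fin d → (Matrix n n ℂ)ˣ, IsMinimiser d (sfClass d L N (C.B₃ * ε₁)) L N (k + 1) V U) ↔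
    (∀ (k : ℕ) (ε₁ : ℝ), 0 < ε₁ → ε₁ ≤ C.a₁ → ∀ V : Site d → Fin d → (Matrix n n ℂ)ˣ, V ∈ sfClass d L N ε₁ 0 →
      (admissible (sfClass d L N (C.B₃ * ε₁)) L (k + 1) V).Nonempty) :=
  ⟨nonempty_admissible_of_exists8Min C, exists8Min_of_nonempty_admissible hL C hr1 hr2⟩

/-! ## §2 The G-free per-site form (T9♭) of the regularity clause (T9ˢ) -/

/-- **★ (T9ˢ) WITH ITS G-SLOT ⟹ THE G-FREE PER-SITE FORM (T9♭).**  From a local-gauge shape `G` monotone in its radii (unused here), its (9)_{β₀=1} interface `hG`, and the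
slot key `hR` (file 9 §1): at every (8)-class minimiser `U` with a loose datum and every site `x` there are a factor `0 ≤ t <  B₃·M_k·ε₁` (`M_k` = the collar-slot cube's size
parameter) and per-site (9)_{β₀=1} gauge data about `x` with radii `(t∕L^{k+1}, t∕L^{2(k+1)}, t∕L^{3(k+1)})` — r2's `Regularity` for the instance puts the infimum `Ψ` of the
admissible factors strictly below the bound, hence a witness `t` (`exists_lt_of_csInf_lt`), and the interface reads the `G`-datum about the centre.  `L ≥ 1`.
[cite: Balaban1985Variational, Thm 1 (9) p.279] -/
theorem perSite_of_reg910Slot {L N : ℕ} (hL : 1 ≤ L)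
    {G : (Site d → Fin d → (Matrix n n ℂ)ˣ) → Site d → ℕ → ℝ → ℝ → ℝ → Prop}
    (hG : ∀ (U : Site d → Fin d → (Matrix n n ℂ)ˣ) (x : Site d) (K : ℕ) (α₀ α₁ α₂ : ℝ), 2 ≤ K → G U x K α₀ α₁ α₂ →
      ∃ (u : Site d → (Matrix n n ℂ)ˣ) (a : Site d → Fin d → Matrix n n ℂ),
        (∀ z, u z ∈ unitaryUnits (Matrix n n ℂ)) ∧
        (∀ (y : Site d) (τ : Fin d), l1 (y - x) ≤ 2 → ((gaugeAct u U y τ : (Matrix n n ℂ)ˣ) : Matrix n n ℂ) = exp (a y τ)) ∧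
        (∀ (y : Site d) (τ : Fin d), l1 (y - x) ≤ 2 → ‖a y τ‖ ≤ α₀) ∧
        (∀ (y : Site d) (τ i : Fin d), l1 (y - x) ≤ 1 → ‖fd i (fun z => a z τ) y‖ ≤ α₁) ∧
        (∀ (τ i l : Fin d), ‖fd i (fd l (fun z => a z τ)) x‖ ≤ α₂))
    (C : B11Thm1.Consts)
    (hR : ∀ (k : ℕ) (ε₁ : ℝ), 0 < ε₁ → ε₁ ≤ C.a₁ → ∀ (V U : Site d → Fin d → (Matrix n n ℂ)ˣ), V ∈ sfClass d L N ε₁ 0 →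
      IsMinimiser d (sfClass d L N (C.B₃ * ε₁)) L N (k + 1) V U →
        ∀ x : Site d, Regularity (torusVP d L N G (k + 1)) C.B₃ C.B₄ ε₁ U (x, L ^ (k + 1) - 1 + L ^ (k + 1) + 2)) :
    ∀ (k : ℕ) (ε₁ : ℝ), 0 < ε₁ → ε₁ ≤ C.a₁ → ∀ (V U : Site d → Fin d → (Matrix n n ℂ)ˣ), V ∈ sfClass d L N ε₁ 0 →
      IsMinimiser d (sfClass d L N (C.B₃ * ε₁)) L N (k + 1) V U →
        ∀ x : Site d, ∃ t : ℝ, 0 ≤ t ∧ t < C.B₃ * cubeM L (k + 1) (L ^ (k + 1) - 1 + L ^ (k + 1) + 2) * ε₁ ∧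
          ∃ (u : Site d → (Matrix n n ℂ)ˣ) (a : Site d → Fin d → Matrix n n ℂ),
            (∀ z, u z ∈ unitaryUnits (Matrix n n ℂ)) ∧
            (∀ (y : Site d) (τ : Fin d), l1 (y - x) ≤ 2 → ((gaugeAct u U y τ : (Matrix n n ℂ)ˣ) : Matrix n n ℂ) = exp (a y τ)) ∧
            (∀ (y : Site d) (τ : Fin d), l1 (y - x) ≤ 2 → ‖a y τ‖ ≤ t / (L : ℝ) ^ (k + 1)) ∧
            (∀ (y : Site d) (τ i : Fin d), l1 (y - x) ≤ 1 → ‖fd i (fun z => a z τ) y‖ ≤ t / ((L : ℝ) ^ (k + 1)) ^ 2) ∧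
            (∀ (τ i l : Fin d), ‖fd i (fd l (fun z => a z τ)) x‖ ≤ t / ((L : ℝ) ^ (k + 1)) ^ 3) := by
  intro k ε₁ hε₁ hε₁a V U hV hU x
  obtain ⟨hne, h9, -, -, -⟩ := hR k ε₁ hε₁ hε₁a V U hV hU x
  have hL0 : (L : ℝ) ^ (k + 1) ≠ 0 := pow_ne_zero _ (by exact_mod_cast (by omega : L ≠ 0))
  have hfac : ((L : ℝ) ^ (k + 1) * ((L : ℝ) ^ (k + 1))⁻¹)⁻¹ ^ 1 = 1 := by
    rw [mul_inv_cancel₀ hL0, inv_one, one_pow]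
  have h9' : gaugeInf G L (k + 1) U x (L ^ (k + 1) - 1 + L ^ (k + 1) + 2)
      < C.B₃ * cubeM L (k + 1) (L ^ (k + 1) - 1 + L ^ (k + 1) + 2) * ε₁ := by
    have := h9
    dsimp only [torusVP] at this
    rwa [hfac, mul_one] at this
  obtain ⟨t, ⟨ht0, htG⟩, htlt⟩ := exists_lt_of_csInf_lt hne h9'
  have hK2 : 2 ≤ L ^ (k + 1) - 1 + L ^ (k + 1) + 2 := by omega
  exact ⟨t, ht0, htlt, hG U x _ _ _ _ hK2 htG⟩

/-- **★ THE G-FREE PER-SITE FORM (T9♭) ⟹ (T9ˢ) FOR A SHAPE WITH THE INTERFACE**: from the per-site data there IS a local-gauge shape `G` — the per-site predicate itself («about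
`x`, unitary `u` and `a` with `U^u = exp a` within `|·|₁ ≤ 2`, `‖a‖ ≤ α₀` there, `‖∇a‖ ≤ α₁` within `1`, `‖∇∇a(x)‖ ≤ α₂`»; the cube parameter `K` is not read) — which is
monotone in its radii, meets the (9)_{β₀=1} interface (by the identity), and satisfies the slot key `hR` at `C`: r2's `Regularity` for `torusVP d L N G (k+1)` on the collar-slot
cube holds with the witness `t` (`Gauged`; `Ψ ≤ t <` the three M-proportional bounds by `csInf_le`; the instance's Hölder slot `0 <` its bound).  `L ≥ 1`.
[cite: Balaban1985Variational, Thm 1 (9)–(10) p.279] -/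
theorem reg910Slot_of_perSite {L N : ℕ} (hL : 1 ≤ L) (C : B11Thm1.Consts)
    (hP : ∀ (k : ℕ) (ε₁ : ℝ), 0 < ε₁ → ε₁ ≤ C.a₁ → ∀ (V U : Site d → Fin d → (Matrix n n ℂ)ˣ), V ∈ sfClass d L N ε₁ 0 →
      IsMinimiser d (sfClass d L N (C.B₃ * ε₁)) L N (k + 1) V U →
        ∀ x : Site d, ∃ t : ℝ, 0 ≤ t ∧ t < C.B₃ * cubeM L (k + 1) (L ^ (k + 1) - 1 + L ^ (k + 1) + 2) * ε₁ ∧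
          ∃ (u : Site d → (Matrix n n ℂ)ˣ) (a : Site d → Fin d → Matrix n n ℂ),
            (∀ z, u z ∈ unitaryUnits (Matrix n n ℂ)) ∧
            (∀ (y : Site d) (τ : Fin d), l1 (y - x) ≤ 2 → ((gaugeAct u U y τ : (Matrix n n ℂ)ˣ) : Matrix n n ℂ) = exp (a y τ)) ∧
            (∀ (y : Site d) (τ : Fin d), l1 (y - x) ≤ 2 → ‖a y τ‖ ≤ t / (L : ℝ) ^ (k + 1)) ∧
            (∀ (y : Site d) (τ i : Fin d), l1 (y - x) ≤ 1 → ‖fd i (fun z => a z τ) y‖ ≤ t / ((L : ℝ) ^ (k + 1)) ^ 2) ∧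
            (∀ (τ i l : Fin d), ‖fd i (fd l (fun z => a z τ)) x‖ ≤ t / ((L : ℝ) ^ (k + 1)) ^ 3)) :
    ∃ G : (Site d → Fin d → (Matrix n n ℂ)ˣ) → Site d → ℕ → ℝ → ℝ → ℝ → Prop,
      RadiiMono d G ∧
      (∀ (U : Site d → Fin d → (Matrix n n ℂ)ˣ) (x : Site d) (K : ℕ) (α₀ α₁ α₂ : ℝ), 2 ≤ K → G U x K α₀ α₁ α₂ →
        ∃ (u : Site d → (Matrix n n ℂ)ˣ) (a : Site d → Fin d → Matrix n n ℂ),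
          (∀ z, u z ∈ unitaryUnits (Matrix n n ℂ)) ∧
          (∀ (y : Site d) (τ : Fin d), l1 (y - x) ≤ 2 → ((gaugeAct u U y τ : (Matrix n n ℂ)ˣ) : Matrix n n ℂ) = exp (a y τ)) ∧
          (∀ (y : Site d) (τ : Fin d), l1 (y - x) ≤ 2 → ‖a y τ‖ ≤ α₀) ∧
          (∀ (y : Site d) (τ i : Fin d), l1 (y - x) ≤ 1 → ‖fd i (fun z => a z τ) y‖ ≤ α₁) ∧
          (∀ (τ i l : Fin d), ‖fd i (fd l (fun z => a z τ)) x‖ ≤ α₂)) ∧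
      (∀ (k : ℕ) (ε₁ : ℝ), 0 < ε₁ → ε₁ ≤ C.a₁ → ∀ (V U : Site d → Fin d → (Matrix n n ℂ)ˣ), V ∈ sfClass d L N ε₁ 0 →
        IsMinimiser d (sfClass d L N (C.B₃ * ε₁)) L N (k + 1) V U →
          ∀ x : Site d, Regularity (torusVP d L N G (k + 1)) C.B₃ C.B₄ ε₁ U (x, L ^ (k + 1) - 1 + L ^ (k + 1) + 2)) := by
  -- the per-site predicate as the shape (the cube parameter is not read)
  let G : (Site d → Fin d → (Matrix n n ℂ)ˣ) → Site d → ℕ → ℝ → ℝ → ℝ → Prop := fun U x _ α₀ α₁ α₂ =>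
    ∃ (u : Site d → (Matrix n n ℂ)ˣ) (a : Site d → Fin d → Matrix n n ℂ),
      (∀ z, u z ∈ unitaryUnits (Matrix n n ℂ)) ∧
      (∀ (y : Site d) (τ : Fin d), l1 (y - x) ≤ 2 → ((gaugeAct u U y τ : (Matrix n n ℂ)ˣ) : Matrix n n ℂ) = exp (a y τ)) ∧
      (∀ (y : Site d) (τ : Fin d), l1 (y - x) ≤ 2 → ‖a y τ‖ ≤ α₀) ∧
      (∀ (y : Site d) (τ i : Fin d), l1 (y - x) ≤ 1 → ‖fd i (fun z => a z τ) y‖ ≤ α₁) ∧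
      (∀ (τ i l : Fin d), ‖fd i (fd l (fun z => a z τ)) x‖ ≤ α₂)
  refine ⟨G, ?_, fun U x K α₀ α₁ α₂ _ h => h, ?_⟩
  · -- monotone in the radii
    rintro U y K a₀ a₁ a₂ b₀ b₁ b₂ h0 h1 h2 ⟨u, a, hu, he, ha0, ha1, ha2⟩
    exact ⟨u, a, hu, he, fun z τ hz => (ha0 z τ hz).trans h0, fun z τ i hz => (ha1 z τ i hz).trans h1,
      fun τ i l => (ha2 τ i l).trans h2⟩
  · -- the slot key from the witness `t`
    intro k ε₁ hε₁ hε₁a V U hV hU x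
    obtain ⟨t, ht0, htlt, hdata⟩ := hP k ε₁ hε₁ hε₁a V U hV hU x
    have hL0 : 0 < L := by omega
    have hLr : (0 : ℝ) < (L : ℝ) := by exact_mod_cast hL0
    have hLk : (L : ℝ) ^ (k + 1) ≠ 0 := pow_ne_zero _ hLr.ne'
    have hmem : t ∈ gaugeFactors G L (k + 1) U x (L ^ (k + 1) - 1 + L ^ (k + 1) + 2) := ⟨ht0, hdata⟩
    have hinf : gaugeInf G L (k + 1) U x (L ^ (k + 1) - 1 + L ^ (k + 1) + 2) ≤ t := csInf_le ⟨0, fun s hs => hs.1⟩ hmem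
    have hM : 0 < cubeM L (k + 1) (L ^ (k + 1) - 1 + L ^ (k + 1) + 2) := cubeM_pos hL _ _
    have hx1 : ((L : ℝ) ^ (k + 1) * ((L : ℝ) ^ (k + 1))⁻¹)⁻¹ = 1 := by rw [mul_inv_cancel₀ hLk, inv_one]
    have hB₃ := C.B₃_pos
    have hB₄ := C.B₄_pos
    unfold Regularity
    dsimp only [torusVP]
    simp only [hx1, one_pow, mul_one, Real.one_rpow]
    refine ⟨⟨t, hmem⟩, hinf.trans_lt htlt, hinf.trans_lt htlt, fun β _ _ => ?_, hinf.trans_lt htlt⟩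
    positivity

/-- **★★ THE SLOT KEY'S REGULARITY CLAUSE IN NORMAL FORM**: for every `C : B11Thm1.Consts` (`L ≥ 1`), «SOME local-gauge shape `G`, monotone in its radii and meeting the
(9)_{β₀=1} interface, satisfies (T9ˢ) at `C`» IFF the G-free per-site statement (T9♭)(C).  Consequently dag-n16-e's ∕ dag-n16-w2's DischargeTest v6 ∕ v6L stub
`stub_reg910Slot F := ∃ G C, RadiiMono ∧ interface ∧ hR` reads, at `(4, F.L, ne3NperOfRecord₁₁ F 0 0)`, «`∃ C`, (T9♭)(C)» — leaf-06's `G`-slot (in particular its trivial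
inhabitant `⊤`, dag-n16-w2's `thm1At_torusVP_top_iff`) carries no content: everything is in the per-site (9)_{β₀=1} data at the printed M-proportional factor.
[cite: Balaban1985Variational, Thm 1 (9)–(10) p.279] -/
theorem slotKey_iff_perSite {L N : ℕ} (hL : 1 ≤ L) (C : B11Thm1.Consts) :
    (∃ G : (Site d → Fin d → (Matrix n n ℂ)ˣ) → Site d → ℕ → ℝ → ℝ → ℝ → Prop,
      RadiiMono d G ∧
      (∀ (U : Site d → Fin d → (Matrix n n ℂ)ˣ) (x : Site d) (K : ℕ) (α₀ α₁ α₂ : ℝ), 2 ≤ K → G U x K α₀ α₁ α₂ →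
        ∃ (u : Site d → (Matrix n n ℂ)ˣ) (a : Site d → Fin d → Matrix n n ℂ),
          (∀ z, u z ∈ unitaryUnits (Matrix n n ℂ)) ∧
          (∀ (y : Site d) (τ : Fin d), l1 (y - x) ≤ 2 → ((gaugeAct u U y τ : (Matrix n n ℂ)ˣ) : Matrix n n ℂ) = exp (a y τ)) ∧
          (∀ (y : Site d) (τ : Fin d), l1 (y - x) ≤ 2 → ‖a y τ‖ ≤ α₀) ∧
          (∀ (y : Site d) (τ i : Fin d), l1 (y - x) ≤ 1 → ‖fd i (fun z => a z τ) y‖ ≤ α₁) ∧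
          (∀ (τ i l : Fin d), ‖fd i (fd l (fun z => a z τ)) x‖ ≤ α₂)) ∧
      (∀ (k : ℕ) (ε₁ : ℝ), 0 < ε₁ → ε₁ ≤ C.a₁ → ∀ (V U : Site d → Fin d → (Matrix n n ℂ)ˣ), V ∈ sfClass d L N ε₁ 0 →
        IsMinimiser d (sfClass d L N (C.B₃ * ε₁)) L N (k + 1) V U →
          ∀ x : Site d, Regularity (torusVP d L N G (k + 1)) C.B₃ C.B₄ ε₁ U (x, L ^ (k + 1) - 1 + L ^ (k + 1) + 2))) ↔
    (∀ (k : ℕ) (ε₁ : ℝ), 0 < ε₁ → ε₁ ≤ C.a₁ → ∀ (V U : Site d → Fin d → (Matrix n n ℂ)ˣ), V ∈ sfClass d L N ε₁ 0 →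
      IsMinimiser d (sfClass d L N (C.B₃ * ε₁)) L N (k + 1) V U →
        ∀ x : Site d, ∃ t : ℝ, 0 ≤ t ∧ t < C.B₃ * cubeM L (k + 1) (L ^ (k + 1) - 1 + L ^ (k + 1) + 2) * ε₁ ∧
          ∃ (u : Site d → (Matrix n n ℂ)ˣ) (a : Site d → Fin d → Matrix n n ℂ),
            (∀ z, u z ∈ unitaryUnits (Matrix n n ℂ)) ∧
            (∀ (y : Site d) (τ : Fin d), l1 (y - x) ≤ 2 → ((gaugeAct u U y τ : (Matrix n n ℂ)ˣ) : Matrix n n ℂ) = exp (a y τ)) ∧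
            (∀ (y : Site d) (τ : Fin d), l1 (y - x) ≤ 2 → ‖a y τ‖ ≤ t / (L : ℝ) ^ (k + 1)) ∧
            (∀ (y : Site d) (τ i : Fin d), l1 (y - x) ≤ 1 → ‖fd i (fun z => a z τ) y‖ ≤ t / ((L : ℝ) ^ (k + 1)) ^ 2) ∧
            (∀ (τ i l : Fin d), ‖fd i (fd l (fun z => a z τ)) x‖ ≤ t / ((L : ℝ) ^ (k + 1)) ^ 3)) :=
  ⟨fun ⟨_, _, hG, hR⟩ => perSite_of_reg910Slot hL hG C hR, reg910Slot_of_perSite hL C⟩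

end

end Summit.QuantumFields.YangMills.BalabanUVNodes.N16SlotKeyNormalForm
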